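import Literature.MathematicalPhysics.QuantumFieldTheory.Federbush1986.PureAverages

/-!
# `Federbush1986.PureAveragesSU2` — P. Federbush, *A phase cell approach to Yang–Mills theory. III. Local stability,
# modified renormalization group transformation*, Commun. Math. Phys. **110** (1987) 293–309 [Federbush1987PhaseCellIII],
# §1 «Pure Averages of Group Elements» p. 294–295: the MODEL INSTANCE `G = SU(2)` of the printed setting (compact Lie group,
# invariant distance, exponential map), with **Lemma 1.0 (1.3) PROVED** for it and the local inverse `log` of `exp`

statement-level skeleton of published theorems with citation tags; proofs where landed; nothing here is a claim about the Yang–Mills mass gap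

PDF held: `fed1987-cmp110-III` (scan `run/shared/lean/pub/pub-balaban/t4/b2b-balaban-t4-lit2/pdf/fed1987-cmp110-III.pdf`, renders
`run/shared/lean/pub/lit-balaban/lit-balaban-r17/renders/fedIII/fed1987-cmp110-III-p003-x2.png` (p. 295) and
`…/b2b-balaban-t4-lit2/renders/fed1987III/fed1987-cmp110-III-p004-x2.png` (p. 296); journal page = PDF page + 292), read as images.

CITATION HEADER (lean-in-tree rule).  lit-balaban cell (HOME `run/shared/lean/pub/lit-balaban/`), SKELETON rows **F3.Eq1.1-1.2**,
**F3.Lem1.0**, **F3.Lem1.3** (reader r17, statement file `…Federbush1986.PureAverages`, p238910 — untouched and imported);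
Phase-2 seat p32 (gen 3), unit `lit-balaban-p32-g3`, kind «model-instance» (PHASE2-TARGETS §G.1).  WHAT IS HERE.  The statement
file types Federbush's setting ABSTRACTLY: a group `G` with a bi-invariant distance (`[Group G] [MetricSpace G]
[IsIsometricSMul G G] [IsIsometricSMul Gᵐᵒᵖ G]`), a real normed Lie algebra `𝔤` and a bare map `exp : 𝔤 → G`; its Lemma-rows
`Lemma10Normalisation exp ρ`, `Lemma13 exp`, … are `Prop`s about such data.  This file builds THE instance print has in mind for
the group of [Balaban1987RG1] Theorem 2 («Let d = 4, G = SU(2)»):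

* `SU2` — the unit quaternions `{q ∈ ℍ : |q| = 1}` (`≅ SU(2)`), a `Group` under quaternion multiplication (inverse = conjugate),
  with the distance `dist p q = arccos ⟨p, q⟩` = the angle between `p, q ∈ S³ ⊂ ℝ⁴` = the geodesic distance of the round
  metric of `S³`, which is THE bi-invariant Riemannian metric of `SU(2)` (unique up to scale) — «d(·,·) an invariant distance
  constructed from an invariant metric on G» (p. 294); `MetricSpace SU2` (triangle inequality = Mathlib's
  `InnerProductGeometry.angle_le_angle_add_angle`), `IsIsometricSMul SU2 SU2` and `IsIsometricSMul SU2ᵐᵒᵖ SU2` PROVED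
  (left/right multiplication by a unit quaternion is orthogonal on `ℝ⁴`);
* `su2` — the Lie algebra `𝔰𝔲(2) = Im ℍ` as a real subspace of `ℍ`, `|A|` = the Euclidean norm (print's `|A|² = −Tr(A²)`
  (1.3) up to the normalisation print allows: «We may normalize d to satisfy (1.3)»);
* `expSU2 : su2 → SU2`, `A ↦ e^A` = Mathlib's exponential `NormedSpace.exp` of the Banach algebra `ℍ` restricted to `Im ℍ`
  (unit-valued by `Quaternion.norm_exp`; closed form `e^A = cos|A| + (sin|A|/|A|) A`, `Quaternion.exp_of_re_eq_zero`);
* **Lemma 1.0 PROVED for the instance**: `dist 1 (e^A) = |A|` for `|A| ≤ π` (`SU2.dist_one_expSU2`), i.e.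
  `SU2.lemma10_SU2 : Lemma10Normalisation expSU2 π` — the typed row F3.Lem1.0 AS TYPED, instantiated;
* `logSU2 : SU2 → su2`, the local inverse of `exp` on `{dist 1 q < π} = SU(2) ∖ {−1}` (`expSU2_logSU2`, `logSU2_expSU2`,
  `norm_logSU2`), equivariant under conjugation (`logSU2_conj_coe`) — the `(1/i) log` of [Balaban1987RG1] (0.10) for this group.

The companion file `…Federbush1986.PureAveragesSU2Lemma13` proves Lemma 1.3 («x = 0 ⇔ ΣA_i = 0», row F3.Lem1.3) for this
instance and its equivalence with Bałaban's averaging equation (0.10).  Deliberately NOT here: Lemmas 1.1–1.2 (rows F3.Lem1.1/1.2,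
fourth/third-order remainder estimates) and Proposition 5.9; no statement about other compact groups.
-/

namespace Literature.MathematicalPhysics.QuantumFieldTheory.Federbush1986

open scoped Quaternion RealInnerProductSpace
open InnerProductGeometry

noncomputable section

/-! ## The carrier: `SU(2)` as the group of unit quaternions with the great-circle distance -/

/-- The group `SU(2)` realised as the unit quaternions `S³ = {q ∈ ℍ : |q| = 1}` — Federbush's «compact Lie Group G» (p. 294) in the
instance `G = SU(2)` of [Balaban1987RG1] Theorem 2. [cite: Federbush1987PhaseCellIII, §1 p. 294] -/
@[ext] structure SU2 : Type where
  /-- the underlying unit quaternion -/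
  val : ℍ
  /-- it has norm one -/
  norm_val : ‖val‖ = 1

namespace SU2

variable (p q g : SU2)

/-- A unit quaternion is non-zero. [cite: Federbush1987PhaseCellIII, §1 p. 294] -/
theorem val_ne_zero : p.val ≠ 0 := by
  intro h
  have h1 := p.norm_val
  rw [h, norm_zero] at h1
  exact zero_ne_one h1

/-- `|q|² = 1`. [cite: Federbush1987PhaseCellIII, §1 p. 294] -/
theorem normSq_val : Quaternion.normSq p.val = 1 := by
  rw [Quaternion.normSq_eq_norm_mul_self, p.norm_val, mul_one]

/-- `q̄ q = 1`. [cite: Federbush1987PhaseCellIII, §1 p. 294] -/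
theorem star_val_mul_val : star p.val * p.val = 1 := by
  rw [Quaternion.star_mul_self, normSq_val, Quaternion.coe_one]

/-- `q q̄ = 1`. [cite: Federbush1987PhaseCellIII, §1 p. 294] -/
theorem val_mul_star_val : p.val * star p.val = 1 := by
  rw [Quaternion.self_mul_star, normSq_val, Quaternion.coe_one]

/-- Multiplication of unit quaternions. [cite: Federbush1987PhaseCellIII, §1 p. 294] -/
instance : Mul SU2 := ⟨fun p q => ⟨p.val * q.val, by rw [norm_mul, p.norm_val, q.norm_val, mul_one]⟩⟩

/-- The identity `ε` (p. 294: «ε will denote the identity»). [cite: Federbush1987PhaseCellIII, §1 p. 294] -/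
instance : One SU2 := ⟨⟨1, norm_one⟩⟩

/-- Inversion = quaternion conjugation on unit quaternions. [cite: Federbush1987PhaseCellIII, §1 p. 294] -/
instance : Inv SU2 := ⟨fun p => ⟨star p.val, by rw [Quaternion.norm_star, p.norm_val]⟩⟩

/-- [cite: Federbush1987PhaseCellIII, §1 p. 294] -/
@[simp] theorem mul_val : (p * q).val = p.val * q.val := rfl

/-- [cite: Federbush1987PhaseCellIII, §1 p. 294] -/
@[simp] theorem one_val : (1 : SU2).val = 1 := rfl

/-- [cite: Federbush1987PhaseCellIII, §1 p. 294] -/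
@[simp] theorem inv_val : p⁻¹.val = star p.val := rfl

/-- `SU(2)` is a group. [cite: Federbush1987PhaseCellIII, §1 p. 294] -/
instance : Group SU2 where
  mul_assoc a b c := SU2.ext (mul_assoc _ _ _)
  one_mul a := SU2.ext (one_mul _)
  mul_one a := SU2.ext (mul_one _)
  inv_mul_cancel a := SU2.ext (by rw [mul_val, inv_val, one_val, star_val_mul_val])

/-- The bi-invariant Riemannian (great-circle) distance of `SU(2) = S³`: `d(p, q) = ∠(p, q) = arccos ⟨p, q⟩` — «d(·,·) an invariant
distance constructed from an invariant metric on G» (p. 294).  Triangle inequality: Mathlib's `angle_le_angle_add_angle`.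
[cite: Federbush1987PhaseCellIII, §1 p. 294] -/
instance : MetricSpace SU2 where
  dist p q := angle p.val q.val
  dist_self p := angle_self p.val_ne_zero
  dist_comm p q := angle_comm p.val q.val
  dist_triangle p q r := angle_le_angle_add_angle p.val q.val r.val
  eq_of_dist_eq_zero := by
    intro p q h
    obtain ⟨-, r, hr, hq⟩ := angle_eq_zero_iff.mp h
    have h1 : r = 1 := by
      have h2 := congrArg norm hq
      rw [norm_smul, p.norm_val, q.norm_val, mul_one, Real.norm_eq_abs, abs_of_pos hr] at h2
      exact h2.symm
    exact SU2.ext (by rw [hq, h1, one_smul])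

/-- `d(p, q)` is the angle between `p` and `q`. [cite: Federbush1987PhaseCellIII, §1 p. 294] -/
theorem dist_def : dist p q = angle p.val q.val := rfl

/-- `d(p, q) = arccos ⟨p, q⟩`. [cite: Federbush1987PhaseCellIII, §1 p. 294] -/
theorem dist_eq : dist p q = Real.arccos ⟪p.val, q.val⟫ := by
  rw [dist_def, angle, p.norm_val, q.norm_val, mul_one, div_one]

/-- `|⟨p, q⟩| ≤ 1`. [cite: Federbush1987PhaseCellIII, §1 p. 294] -/
theorem abs_inner_le_one : |⟪p.val, q.val⟫| ≤ 1 := by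
  have := abs_real_inner_le_norm p.val q.val
  rwa [p.norm_val, q.norm_val, mul_one] at this

/-- `cos d(p, q) = ⟨p, q⟩`. [cite: Federbush1987PhaseCellIII, §1 p. 294] -/
theorem cos_dist : Real.cos (dist p q) = ⟪p.val, q.val⟫ := by
  rw [dist_eq]
  have := p.abs_inner_le_one q
  exact Real.cos_arccos (by linarith [neg_abs_le ⟪p.val, q.val⟫]) (by linarith [le_abs_self ⟪p.val, q.val⟫])

/-- `d(p, q) ≤ π` (the diameter of `S³`). [cite: Federbush1987PhaseCellIII, §1 p. 294] -/
theorem dist_le_pi : dist p q ≤ Real.pi := by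
  rw [dist_eq]; exact Real.arccos_le_pi _

/-- Conjugation by `g` multiplies real parts by `|g|²`. [cite: Federbush1987PhaseCellIII, §1 p. 294] -/
theorem re_conj (g x : ℍ) : (g * x * star g).re = Quaternion.normSq g * x.re := by
  simp only [Quaternion.re_mul, Quaternion.imI_mul, Quaternion.imJ_mul, Quaternion.imK_mul,
    Quaternion.re_star, Quaternion.imI_star, Quaternion.imJ_star, Quaternion.imK_star,
    Quaternion.normSq_def']
  ring

/-- Left multiplication preserves `⟨·,·⟩`. [cite: Federbush1987PhaseCellIII, §1 p. 294] -/
theorem inner_mul_left : ⟪(g * p).val, (g * q).val⟫ = ⟪p.val, q.val⟫ := by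
  rw [Quaternion.inner_def, Quaternion.inner_def, mul_val, mul_val, star_mul,
    show g.val * p.val * (star q.val * star g.val) = g.val * (p.val * star q.val) * star g.val by
      simp only [mul_assoc],
    re_conj, normSq_val, one_mul]

/-- Right multiplication preserves `⟨·,·⟩`. [cite: Federbush1987PhaseCellIII, §1 p. 294] -/
theorem inner_mul_right : ⟪(p * g).val, (q * g).val⟫ = ⟪p.val, q.val⟫ := by
  rw [Quaternion.inner_def, Quaternion.inner_def, mul_val, mul_val, star_mul,
    show p.val * g.val * (star g.val * star q.val) = p.val * (g.val * star g.val) * star q.val by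
      simp only [mul_assoc],
    val_mul_star_val, mul_one]

/-- LEFT INVARIANCE «d(kg, kh) = d(g, h)» of the distance — PROVED. [cite: Federbush1987PhaseCellIII, §1 p. 294] -/
instance : IsIsometricSMul SU2 SU2 :=
  ⟨fun g => Isometry.of_dist_eq fun p q => by simp only [smul_eq_mul, dist_eq, inner_mul_left]⟩

/-- RIGHT INVARIANCE «d(gk, hk) = d(g, h)» of the distance — PROVED. [cite: Federbush1987PhaseCellIII, §1 p. 294] -/
instance : IsIsometricSMul SU2ᵐᵒᵖ SU2 :=
  ⟨fun g => Isometry.of_dist_eq fun p q => by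
    simp only [MulOpposite.smul_eq_mul_unop, dist_eq, inner_mul_right]⟩

/-- `⟨x, c⟩ = c·Re x` for real `c`. [cite: Federbush1987PhaseCellIII, §1 p. 294] -/
theorem inner_coe_right (x : ℍ) (c : ℝ) : ⟪x, (c : ℍ)⟫ = x.re * c := by
  rw [Quaternion.inner_def, Quaternion.star_coe, Quaternion.re_mul]
  simp

/-- `⟨c, x⟩ = c·Re x` for real `c`. [cite: Federbush1987PhaseCellIII, §1 p. 294] -/
theorem inner_coe_left (c : ℝ) (x : ℍ) : ⟪(c : ℍ), x⟫ = c * x.re := by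
  rw [real_inner_comm, inner_coe_right, mul_comm]

/-- `(Re x)² + |Im x|² = |x|²`. [cite: Federbush1987PhaseCellIII, §1 p. 294] -/
theorem sq_re_add_normSq_im (x : ℍ) : x.re ^ 2 + Quaternion.normSq x.im = Quaternion.normSq x := by
  rw [Quaternion.normSq_def', Quaternion.normSq_def']
  simp only [Quaternion.re_im, Quaternion.imI_im, Quaternion.imJ_im, Quaternion.imK_im]
  ring

/-- `|Im p|² = 1 − (Re p)²` on `S³`. [cite: Federbush1987PhaseCellIII, §1 p. 294] -/
theorem norm_im_sq : ‖p.val.im‖ ^ 2 = 1 - p.val.re ^ 2 := by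
  have h := sq_re_add_normSq_im p.val
  rw [normSq_val, Quaternion.normSq_eq_norm_mul_self, ← sq] at h
  linarith

/-- [cite: Federbush1987PhaseCellIII, §1 p. 294] -/
theorem re_sq_le_one : p.val.re ^ 2 ≤ 1 := by
  have := p.norm_im_sq
  nlinarith [sq_nonneg ‖p.val.im‖]

/-- `Re p ≤ 1`. [cite: Federbush1987PhaseCellIII, §1 p. 294] -/
theorem re_le_one : p.val.re ≤ 1 := by
  have h := p.re_sq_le_one
  nlinarith

/-- `−1 ≤ Re p`. [cite: Federbush1987PhaseCellIII, §1 p. 294] -/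
theorem neg_one_le_re : -1 ≤ p.val.re := by
  have h := p.re_sq_le_one
  nlinarith

/-- The only unit quaternion with real part `1` is `ε`. [cite: Federbush1987PhaseCellIII, §1 p. 294] -/
theorem eq_one_of_re_eq_one (h : p.val.re = 1) : p = 1 := by
  have him : p.val.im = 0 := by
    have h2 := p.norm_im_sq
    rw [h, one_pow, sub_self, sq_eq_zero_iff, norm_eq_zero] at h2
    exact h2
  apply SU2.ext
  rw [← Quaternion.re_add_im p.val, him, add_zero, h, one_val, Quaternion.coe_one]

/-- «|g| = d(ε, g)» (p. 299) in the instance: `d(ε, p) = arccos (Re p)`. [cite: Federbush1987PhaseCellIII, §5.1 p. 299] -/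
theorem dist_one_left : dist 1 p = Real.arccos p.val.re := by
  rw [dist_eq, one_val, ← Quaternion.coe_one, inner_coe_left, one_mul]

end SU2

/-! ## The Lie algebra `𝔰𝔲(2) = Im ℍ` and the exponential map -/

/-- The Lie algebra `𝔰𝔲(2)` of `SU(2)`, realised as the imaginary quaternions `Im ℍ ≅ ℝ³` with the Euclidean norm — «A in the Lie
Algebra», `|A|` (p. 295). [cite: Federbush1987PhaseCellIII, §1 (1.3) p. 295] -/
def su2 : Submodule ℝ ℍ where
  carrier := {A | A.re = 0}
  add_mem' {a b} ha hb := by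
    simp only [Set.mem_setOf_eq] at ha hb ⊢
    rw [Quaternion.re_add, ha, hb, add_zero]
  zero_mem' := by simp only [Set.mem_setOf_eq]; rfl
  smul_mem' c a ha := by
    simp only [Set.mem_setOf_eq] at ha ⊢
    rw [Quaternion.re_smul, ha, smul_zero]

namespace su2

variable (A : su2)

/-- Elements of `𝔰𝔲(2)` have zero real part. [cite: Federbush1987PhaseCellIII, §1 p. 295] -/
theorem re_coe : (A : ℍ).re = 0 := A.2

/-- Elements of `𝔰𝔲(2)` are their own imaginary part. [cite: Federbush1987PhaseCellIII, §1 p. 295] -/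
theorem im_coe : (A : ℍ).im = A := by
  have h := Quaternion.re_add_im (A : ℍ)
  rwa [su2.re_coe A, Quaternion.coe_zero, zero_add] at h

/-- The norm of `𝔰𝔲(2)` is the ambient (Euclidean) norm. [cite: Federbush1987PhaseCellIII, §1 (1.3) p. 295] -/
theorem norm_coe : ‖(A : ℍ)‖ = ‖A‖ := rfl

/-- `𝔰𝔲(2) ⊥ ℝ·1`. [cite: Federbush1987PhaseCellIII, §1 p. 295] -/
theorem inner_coe_left_eq_zero (c : ℝ) : ⟪(c : ℍ), (A : ℍ)⟫ = 0 := by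
  rw [SU2.inner_coe_left, su2.re_coe A, mul_zero]

/-- Imaginary parts lie in `𝔰𝔲(2)`. [cite: Federbush1987PhaseCellIII, §1 p. 295] -/
theorem im_mem (x : ℍ) : x.im ∈ su2 := Quaternion.re_im x

end su2

/-- The exponential map `A ↦ e^A` of `SU(2)` («elements g = e^A», p. 294) = the exponential series of the Banach algebra `ℍ` on
`Im ℍ` (unit-valued: `Quaternion.norm_exp`). [cite: Federbush1987PhaseCellIII, §1 (1.1) p. 294] -/
def expSU2 (A : su2) : SU2 :=
  ⟨NormedSpace.exp (A : ℍ), by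
    rw [Quaternion.norm_exp, su2.re_coe A, NormedSpace.exp_zero, norm_one]⟩

namespace SU2

variable (A : su2) (p g : SU2)

/-- Closed form `e^A = cos|A| + (sin|A|/|A|)·A` (`Quaternion.exp_of_re_eq_zero`). [cite: Federbush1987PhaseCellIII, §1 (1.1) p. 294] -/
theorem expSU2_val : (expSU2 A).val = ↑(Real.cos ‖A‖) + (Real.sin ‖A‖ / ‖A‖) • (A : ℍ) := by
  show NormedSpace.exp (A : ℍ) = _
  rw [Quaternion.exp_of_re_eq_zero _ (su2.re_coe A), su2.norm_coe]

/-- `e^A` IS the exponential. [cite: Federbush1987PhaseCellIII, §1 (1.1) p. 294] -/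
theorem expSU2_val_eq_exp : (expSU2 A).val = NormedSpace.exp (A : ℍ) := rfl

/-- `e^0 = ε`. [cite: Federbush1987PhaseCellIII, §1 (1.1) p. 294] -/
@[simp] theorem expSU2_zero : expSU2 0 = 1 := by
  apply SU2.ext
  rw [expSU2_val_eq_exp, Submodule.coe_zero, NormedSpace.exp_zero, one_val]

/-- `Re e^A = cos|A|`. [cite: Federbush1987PhaseCellIII, §1 (1.1) p. 294] -/
theorem re_expSU2 : (expSU2 A).val.re = Real.cos ‖A‖ := by
  rw [expSU2_val, Quaternion.re_add, Quaternion.re_coe, Quaternion.re_smul, su2.re_coe A, smul_zero, add_zero]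

/-- `Im e^A = (sin|A|/|A|) A`. [cite: Federbush1987PhaseCellIII, §1 (1.1) p. 294] -/
theorem im_expSU2 : (expSU2 A).val.im = (Real.sin ‖A‖ / ‖A‖) • (A : ℍ) := by
  rw [expSU2_val, Quaternion.im_add, Quaternion.im_coe, zero_add, Quaternion.im_smul, su2.im_coe A]

/-- `⟨x, e^A⟩ = Re x · cos|A| + (sin|A|/|A|)⟨x, A⟩`. [cite: Federbush1987PhaseCellIII, §1 (1.1) p. 294] -/
theorem inner_expSU2 (x : ℍ) :
    ⟪x, (expSU2 A).val⟫ = x.re * Real.cos ‖A‖ + Real.sin ‖A‖ / ‖A‖ * ⟪x, (A : ℍ)⟫ := by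
  rw [expSU2_val, inner_add_right, inner_smul_right, inner_coe_right]

/-- The spherical law of cosines at the identity: `cos d(p, e^A) = Re p · cos|A| + (sin|A|/|A|)⟨p, A⟩`.
[cite: Federbush1987PhaseCellIII, §1 (1.2) p. 295] -/
theorem cos_dist_expSU2 : Real.cos (dist p (expSU2 A)) =
    p.val.re * Real.cos ‖A‖ + Real.sin ‖A‖ / ‖A‖ * ⟪p.val, (A : ℍ)⟫ := by
  rw [cos_dist, inner_expSU2]

/-- **Lemma 1.0 for `SU(2)`**: `d(ε, e^A) = |A|` whenever `|A| ≤ π`. [cite: Federbush1987PhaseCellIII, Lemma 1.0 (1.3) p. 295] -/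
theorem dist_one_expSU2 (hA : ‖A‖ ≤ Real.pi) : dist 1 (expSU2 A) = ‖A‖ := by
  rw [dist_one_left, re_expSU2, Real.arccos_cos (norm_nonneg _) hA]

/-- **Lemma 1.0** «We may normalize d to satisfy d²(ε, e^A) = A² ≡ −Tr(A²) ≡ |A|². (1.3)» — the typed row F3.Lem1.0
`Lemma10Normalisation` HOLDS for the model instance `G = SU(2)` (great-circle distance, `|A|` Euclidean on `Im ℍ`), on the radius
`ρ = π`. [cite: Federbush1987PhaseCellIII, Lemma 1.0 (1.3) p. 295] -/
theorem lemma10_SU2 : Lemma10Normalisation expSU2 Real.pi := fun A hA => by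
  rw [absG_def]; exact dist_one_expSU2 A hA.le

/-- Left invariance in use: `d(ε, ḡ⁻¹g) = d(ḡ, g)` ((1.6) «d²(e^A, e^B) = d²(ε, e^{−A}e^B)»).
[cite: Federbush1987PhaseCellIII, (1.6) p. 295] -/
theorem dist_one_inv_mul : dist 1 (g⁻¹ * p) = dist g p := by
  rw [← dist_mul_left g (1 : SU2) (g⁻¹ * p), mul_one, mul_inv_cancel_left]

end SU2

/-! ## The logarithm: the local inverse of `exp` on `SU(2) ∖ {−ε}` -/

/-- `log : SU(2) → 𝔰𝔲(2)`, `log q = (arccos (Re q)/|Im q|)·Im q` (and `0` at `q = ±ε`): the inverse of `exp` on `{d(ε, q) < π}`, with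
`|log q| = d(ε, q)` — the `(1/i) log U` of [Balaban1987RG1] (0.10) in this group. [cite: Federbush1987PhaseCellIII, §1 (1.1), (1.7) p. 295] -/
def logSU2 (p : SU2) : su2 :=
  ⟨(Real.arccos p.val.re / ‖p.val.im‖) • p.val.im, su2.smul_mem _ (su2.im_mem p.val)⟩

namespace SU2

variable (A : su2) (p g : SU2)

/-- [cite: Federbush1987PhaseCellIII, §1 (1.7) p. 295] -/
theorem logSU2_coe : (logSU2 p : ℍ) = (Real.arccos p.val.re / ‖p.val.im‖) • p.val.im := rfl

/-- `log ε = 0`. [cite: Federbush1987PhaseCellIII, §1 (1.7) p. 295] -/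
@[simp] theorem logSU2_one : logSU2 1 = 0 := by
  apply Subtype.ext
  rw [logSU2_coe, one_val, Quaternion.im_one, smul_zero, Submodule.coe_zero]

/-- `Im p = 0 ⇔ p = ±ε`. [cite: Federbush1987PhaseCellIII, §1 p. 294] -/
theorem im_eq_zero_iff : p.val.im = 0 ↔ p.val.re = 1 ∨ p.val.re = -1 := by
  have h := p.norm_im_sq
  constructor
  · intro h0
    rw [h0, norm_zero] at h
    have : (p.val.re - 1) * (p.val.re + 1) = 0 := by nlinarith
    rcases mul_eq_zero.mp this with h1 | h1
    · left; linarith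
    · right; linarith
  · intro h1
    rcases h1 with h1 | h1 <;>
    · rw [h1] at h
      have : ‖p.val.im‖ ^ 2 = 0 := by nlinarith
      rwa [sq_eq_zero_iff, norm_eq_zero] at this

/-- `d(ε, p) < π` excludes `p = −ε`. [cite: Federbush1987PhaseCellIII, §1 p. 294] -/
theorem re_ne_neg_one_of_dist_lt (hp : dist 1 p < Real.pi) : p.val.re ≠ -1 := by
  intro h
  rw [dist_one_left, h, Real.arccos_neg_one] at hp
  exact lt_irrefl _ hp

/-- `|log p| = d(ε, p)` for `d(ε, p) < π`. [cite: Federbush1987PhaseCellIII, §1 (1.3), (1.7) p. 295] -/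
theorem norm_logSU2 (hp : dist 1 p < Real.pi) : ‖logSU2 p‖ = dist 1 p := by
  rw [← su2.norm_coe, logSU2_coe, dist_one_left]
  by_cases him : p.val.im = 0
  · have hre : p.val.re = 1 := by
      rcases (im_eq_zero_iff p).mp him with h | h
      · exact h
      · exact absurd h (re_ne_neg_one_of_dist_lt p hp)
    rw [him, smul_zero, norm_zero, hre, Real.arccos_one]
  · rw [norm_smul, Real.norm_eq_abs, abs_of_nonneg (div_nonneg (Real.arccos_nonneg _) (norm_nonneg _)),
      div_mul_cancel₀ _ (norm_ne_zero_iff.mpr him)]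

/-- `sin d(ε, p) = |Im p|`. [cite: Federbush1987PhaseCellIII, §1 p. 295] -/
theorem sin_arccos_re : Real.sin (Real.arccos p.val.re) = ‖p.val.im‖ := by
  rw [Real.sin_arccos, ← norm_im_sq, Real.sqrt_sq (norm_nonneg _)]

/-- `e^{log p} = p` for `d(ε, p) < π`. [cite: Federbush1987PhaseCellIII, §1 (1.7) p. 295] -/
theorem expSU2_logSU2 (hp : dist 1 p < Real.pi) : expSU2 (logSU2 p) = p := by
  by_cases him : p.val.im = 0
  · have hre : p.val.re = 1 := by
      rcases (im_eq_zero_iff p).mp him with h | h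
      · exact h
      · exact absurd h (re_ne_neg_one_of_dist_lt p hp)
    have hp1 : p = 1 := eq_one_of_re_eq_one p hre
    subst hp1
    rw [logSU2_one, expSU2_zero]
  · apply SU2.ext
    have hθ : Real.arccos p.val.re ≠ 0 := by
      intro h0
      have := sin_arccos_re p
      rw [h0, Real.sin_zero] at this
      exact him (norm_eq_zero.mp this.symm)
    have hn : ‖p.val.im‖ ≠ 0 := norm_ne_zero_iff.mpr him
    rw [expSU2_val, norm_logSU2 p hp, dist_one_left, Real.cos_arccos (neg_one_le_re p) (re_le_one p),
      logSU2_coe, smul_smul, sin_arccos_re,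
      show ‖p.val.im‖ / Real.arccos p.val.re * (Real.arccos p.val.re / ‖p.val.im‖) = 1 by
        field_simp,
      one_smul, Quaternion.re_add_im]

/-- `log e^A = A` for `|A| < π`. [cite: Federbush1987PhaseCellIII, §1 (1.7) p. 295] -/
theorem logSU2_expSU2 (hA : ‖A‖ < Real.pi) : logSU2 (expSU2 A) = A := by
  apply Subtype.ext
  rw [logSU2_coe, re_expSU2, im_expSU2, Real.arccos_cos (norm_nonneg _) hA.le]
  by_cases hA0 : A = 0
  · subst hA0; simp
  · have ha : 0 < ‖A‖ := norm_pos_iff.mpr hA0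
    have hsin : 0 < Real.sin ‖A‖ := Real.sin_pos_of_pos_of_lt_pi ha hA
    rw [norm_smul, su2.norm_coe, Real.norm_eq_abs, abs_of_pos (div_pos hsin ha), smul_smul,
      show ‖A‖ / (Real.sin ‖A‖ / ‖A‖ * ‖A‖) * (Real.sin ‖A‖ / ‖A‖) = 1 by field_simp, one_smul]

/-- `Im (g x ḡ) = g (Im x) ḡ` for a unit quaternion `g`. [cite: Federbush1987PhaseCellIII, §1 p. 294] -/
theorem im_conj (x : ℍ) : (g.val * x * star g.val).im = g.val * x.im * star g.val := by
  have h1 : g.val * x * star g.val = ↑x.re + g.val * x.im * star g.val := by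
    conv_lhs => rw [← Quaternion.re_add_im x]
    rw [mul_add, add_mul, ← Quaternion.coe_commutes x.re g.val, mul_assoc (x.re : ℍ) g.val (star g.val),
      val_mul_star_val, mul_one]
  have h2 : (g.val * x.im * star g.val).re = 0 := by
    rw [re_conj, Quaternion.re_im, mul_zero]
  rw [h1, Quaternion.im_add, Quaternion.im_coe, zero_add]
  have h3 := Quaternion.re_add_im (g.val * x.im * star g.val)
  rw [h2, Quaternion.coe_zero, zero_add] at h3
  exact h3

/-- `|g x ḡ| = |x|` for a unit quaternion `g`. [cite: Federbush1987PhaseCellIII, §1 p. 294] -/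
theorem norm_conj (x : ℍ) : ‖g.val * x * star g.val‖ = ‖x‖ := by
  rw [norm_mul, norm_mul, Quaternion.norm_star, g.norm_val, one_mul, mul_one]

/-- `log` is conjugation-equivariant: `log (g p g⁻¹) = g (log p) g⁻¹` (the adjoint action on `𝔰𝔲(2)`); used for the two printed forms
`log (U_j U⁻¹)` / `log (U⁻¹ U_j)` of [Balaban1987RG1] (0.10). [cite: Federbush1987PhaseCellIII, §1 (1.6)–(1.7) p. 295] -/
theorem logSU2_conj_coe : (logSU2 (g * p * g⁻¹) : ℍ) = g.val * (logSU2 p : ℍ) * star g.val := by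
  rw [logSU2_coe, logSU2_coe, mul_val, mul_val, inv_val, re_conj, normSq_val, one_mul, im_conj, norm_conj,
    Algebra.mul_smul_comm, Algebra.smul_mul_assoc]

end SU2

end

end Literature.MathematicalPhysics.QuantumFieldTheory.Federbush1986
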